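import Summits.QuantumFields.YangMills.Theorems.ColdStartUniversalityLatticeLangevinReverseLocalPoincare
import HarnessLib

/-!
# Route `ColdStartUniversality` (fixed-cut-off package, Bakry–Émery side, GRADIENT half): the POINTWISE gradient bound for `C³` DATA with a
# `C³` representative of the generator — `e^((2−K₀)t)·Γ^A(κ_t F)(x) ≤ κ_t(Γ^A F)(x)` — in particular for `F = κ_s F₀` in the Dynkin class

Helper file (seat `ym-line-csu-p1`, g29; `--supports stmt-QuantumFields-24809`).  Pointwise form of `integral_mul_carre_transition_le_of_generatorRep`
(the `C⁵` hypothesis of `wilson_carre_transition_le_of_hessBound` is only used to produce a `C³_c` representative of `𝓛f`; for `f = κ_s f₀`,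
`f₀ ∈ C⁵_c`, such a representative is `κ_s(𝓛f₀)` by `transitionKernel_backwardKolmogorov`, although `f` itself is only known to be `C³`):
* ★★ `coords_injective`, `isClosedEmbedding_coords` — the real link coordinates embed `SU(2)^E` as a closed subset of the flat coordinate space
  (so small coordinate balls around `coords x₀` pull back to small neighbourhoods of `x₀`; this replaces the ambient-continuity device of
  `…BakryEmeryGradientBound`);
* ★★★ `wilson_carre_transition_le_of_generatorRep` — under the frame Hessian bound `K₀`: for `C³_c` `f` and `a` with `a∘coords = 𝓛f`, any
  realising kernel family `κ`, `t ≥ 0`, any `C¹` `g'` with `κ_t(f∘coords) = g'∘coords`:  `e^((2−K₀)t)·Γ^A(g')(x) ≤ κ_t(Γ^A f)(x)` for all `x`;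
* ★★★ `wilson_lipschitz_decay_of_bounded_uniform` — `|β'| < 1/12`, `c = 2(1−12|β'|)`: for every `L`, every `C⁵` `f₀` with `|f₀∘coords| ≤ M` on the
  group, `t > 0`, `s ≥ 0` and any `C¹` representative `g` of `κ_(t+s)(f₀∘coords)`:  `Γ^A(g)(x) ≤ e^(−cs)·(c/(e^(ct) − 1))·M²` — the Lipschitz
  seminorm of `x ↦ E f₀(U_(t+s)^x)` DECAYS EXPONENTIALLY for every BOUNDED smooth observable, with constants independent of the derivatives of `f₀`
  and of the volume (reverse local Poincaré at time `t`, then contraction from `t` to `t+s`).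
THEOREMS ONLY, no definition, no sorry.  HONEST FRAMING: fixed cut-off; "uniform" = in `L` at fixed `|β'| < 1/12`; the route's scaling
`β'_K → ∞` leaves this window; nothing K-uniform; no crux, rung or summit statement is proved; the Yang–Mills mass gap is NOT proved.
-/

set_option autoImplicit false

noncomputable section

namespace Summit.QuantumFields.YangMills.Theorems.ColdStartUniversality

open MeasureTheory ProbabilityTheory Matrix Complex Finset Filter Set Metric Topology
open scoped ComplexConjugate BigOperators Matrix NNReal ENNReal Topology
open Literature.Probability.Process Literature.MathematicalPhysics.QuantumFieldTheory
open Literature.MathematicalPhysics.QuantumLattice (fundamentalRep fundamentalLatticeRep continuous_fundamentalRep fundamentalRep_apply fundamentalRep_injective)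

variable {L : ℕ} [NeZero L]

/-- ★★ **The real link coordinates are injective** on `SU(2)^E`. [folklore] -/
theorem coords_injective (L : ℕ) [NeZero L] :
    Function.Injective (fun (V : GaugeConfig 3 L (Matrix.specialUnitaryGroup (Fin 2) ℂ)) (q : Edge 3 L × Fin (fundamentalLatticeRep 2).N × Fin (fundamentalLatticeRep 2).N × Bool) => (fun z : ℂ => if q.2.2.2 then z.im else z.re) ((fundamentalRep (Fin 2) (V q.1) : Matrix (Fin 2) (Fin 2) ℂ) q.2.1 q.2.2.1)) := by
  intro V V' h
  funext e
  apply Subtype.ext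
  ext i j
  apply Complex.ext
  · have h1 := congrFun h (e, i, j, false)
    simpa [fundamentalRep_apply] using h1
  · have h1 := congrFun h (e, i, j, true)
    simpa [fundamentalRep_apply] using h1

/-- ★★ **`coords` is a closed embedding** of the compact group `SU(2)^E` into the flat coordinate space. [folklore] -/
theorem isClosedEmbedding_coords (L : ℕ) [NeZero L] :
    IsClosedEmbedding (fun (V : GaugeConfig 3 L (Matrix.specialUnitaryGroup (Fin 2) ℂ)) (q : Edge 3 L × Fin (fundamentalLatticeRep 2).N × Fin (fundamentalLatticeRep 2).N × Bool) => (fun z : ℂ => if q.2.2.2 then z.im else z.re) ((fundamentalRep (Fin 2) (V q.1) : Matrix (Fin 2) (Fin 2) ℂ) q.2.1 q.2.2.1)) :=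
  (continuous_coords (L := L)).isClosedEmbedding (coords_injective L)

/-- ★★★ **Pointwise gradient bound for `C³` data with a `C³` representative of the generator.**  Under the frame Hessian bound `K₀`: for `C³`
compactly supported `f` and `a` with `a∘coords = 𝓛f` on the group, any realising Markov kernel family `κ`, `t ≥ 0`, any `C¹` `g'` with
`κ_t(f∘coords) = g'∘coords`, and every configuration `x`:  `e^((2−K₀)t)·Γ^A(g')(x) ≤ κ_t(Γ^A f)(x)`.
[cite: BakryGentilLedoux2014, Thm 3.2.3 and Thm 3.3.18] -/
theorem wilson_carre_transition_le_of_generatorRep (L : ℕ) [NeZero L] (β' K₀ : ℝ)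
    (hHess : (∀ (V : (GaugeConfig 3 L (Matrix.specialUnitaryGroup (Fin 2) ℂ))) (Λ : (Edge 3 L × Fin (fundamentalLatticeRep 2).N × Fin (fundamentalLatticeRep 2).N × Bool → ℝ) →L[ℝ] ℝ),
      ∑ n : Edge 3 L × NoiseIdx (fundamentalLatticeRep 2).N, ∑ m : Edge 3 L × NoiseIdx (fundamentalLatticeRep 2).N,
        Λ ((fun q : Edge 3 L × Fin (fundamentalLatticeRep 2).N × Fin (fundamentalLatticeRep 2).N × Bool => if n.1 = q.1 then (fun z : ℂ => if q.2.2.2 then z.im else z.re) (((Real.sqrt 2 : ℂ) • ((fundamentalLatticeRep 2).lieProj (noiseDir n.2) * (fun (ee : Edge 3 L) => Matrix.of fun (i j : Fin (fundamentalLatticeRep 2).N) => (((fun (V : GaugeConfig 3 L (Matrix.specialUnitaryGroup (Fin 2) ℂ)) (q : Edge 3 L × Fin (fundamentalLatticeRep 2).N × Fin (fundamentalLatticeRep 2).N × Bool) => (fun z : ℂ => if q.2.2.2 then z.im else z.re) ((fundamentalRep (Fin 2) (V q.1) : Matrix (Fin 2) (Fin 2) ℂ) q.2.1 q.2.2.1))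 V (ee, i, j, false) : ℝ) : ℂ) + (((fun (V : GaugeConfig 3 L (Matrix.specialUnitaryGroup (Fin 2) ℂ)) (q : Edge 3 L × Fin (fundamentalLatticeRep 2).N × Fin (fundamentalLatticeRep 2).N × Bool) => (fun z : ℂ => if q.2.2.2 then z.im else z.re) ((fundamentalRep (Fin 2) (V q.1) : Matrix (Fin 2) (Fin 2) ℂ) q.2.1 q.2.2.1)) V (ee, i, j, true) : ℝ) : ℂ) * Complex.I) q.1)) q.2.1 q.2.2.1) else 0)) * Λ ((fun q : Edge 3 L × Fin (fundamentalLatticeRep 2).N × Fin (fundamentalLatticeRep 2).N × Bool => if m.1 = q.1 then (fun z : ℂ => if q.2.2.2 then z.im else z.re) (((Real.sqrt 2 : ℂ) • ((fundamentalLatticeRep 2).lieProj (noiseDir m.2) * (fun (ee : Edge 3 L) => Matrix.of fun (i j : Fin (fundamentalLatticeRep 2).N) => (((fun (V : GaugeConfig 3 L (Matrix.specialUnitaryGroup (Fin 2) ℂ)) (q : Edge 3 L × Fin (fundamentalLatticeRep 2).N × Fin (fundamentalLatticeRep 2).N × Bool) => (fun z : ℂ => if q.2.2.2 then z.im else z.re)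 ((fundamentalRep (Fin 2) (V q.1) : Matrix (Fin 2) (Fin 2) ℂ) q.2.1 q.2.2.1)) V (ee, i, j, false) : ℝ) : ℂ) + (((fun (V : GaugeConfig 3 L (Matrix.specialUnitaryGroup (Fin 2) ℂ)) (q : Edge 3 L × Fin (fundamentalLatticeRep 2).N × Fin (fundamentalLatticeRep 2).N × Bool) => (fun z : ℂ => if q.2.2.2 then z.im else z.re) ((fundamentalRep (Fin 2) (V q.1) : Matrix (Fin 2) (Fin 2) ℂ) q.2.1 q.2.2.1)) V (ee, i, j, true) : ℝ) : ℂ) * Complex.I) q.1)) q.2.1 q.2.2.1) else 0)) *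
          fderiv ℝ (fun z : (Edge 3 L × Fin (fundamentalLatticeRep 2).N × Fin (fundamentalLatticeRep 2).N × Bool → ℝ) => fderiv ℝ (fun y : (Edge 3 L × Fin (fundamentalLatticeRep 2).N × Fin (fundamentalLatticeRep 2).N × Bool → ℝ) => β' * ∑ p : Plaquette 3 L, (rootedLoop (fun (ee : Edge 3 L) (i j : Fin (fundamentalLatticeRep 2).N) => ((y (ee, i, j, false) : ℝ) : ℂ) + ((y (ee, i, j, true) : ℝ) : ℂ) * Complex.I) (p.1, p.2.1.1) p.2.1.2 false).trace.re) z (fun q : Edge 3 L × Fin (fundamentalLatticeRep 2).N × Fin (fundamentalLatticeRep 2).N × Bool => if m.1 = q.1 then (fun z : ℂ => if q.2.2.2 then z.im else z.re) (((Real.sqrt 2 : ℂ) • ((fundamentalLatticeRep 2).lieProj (noiseDir m.2) * (fun (ee : Edge 3 L) => Matrix.of fun (i j : Fin (fundamentalLatticeRep 2).N) => ((z (ee, i, j, false) : ℝ) : ℂ) + ((z (ee, i, j, true) : ℝ) : ℂ) * Complex.I) q.1)) q.2.1 q.2.2.1) else 0)) ((fun (V : GaugeConfig 3 L (Matrix.specialUnitaryGroup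 (Fin 2) ℂ)) (q : Edge 3 L × Fin (fundamentalLatticeRep 2).N × Fin (fundamentalLatticeRep 2).N × Bool) => (fun z : ℂ => if q.2.2.2 then z.im else z.re) ((fundamentalRep (Fin 2) (V q.1) : Matrix (Fin 2) (Fin 2) ℂ) q.2.1 q.2.2.1)) V) (fun q : Edge 3 L × Fin (fundamentalLatticeRep 2).N × Fin (fundamentalLatticeRep 2).N × Bool => if n.1 = q.1 then (fun z : ℂ => if q.2.2.2 then z.im else z.re) (((Real.sqrt 2 : ℂ) • ((fundamentalLatticeRep 2).lieProj (noiseDir n.2) * (fun (ee : Edge 3 L) => Matrix.of fun (i j : Fin (fundamentalLatticeRep 2).N) => (((fun (V : GaugeConfig 3 L (Matrix.specialUnitaryGroup (Fin 2) ℂ)) (q : Edge 3 L × Fin (fundamentalLatticeRep 2).N × Fin (fundamentalLatticeRep 2).N × Bool) => (fun z : ℂ => if q.2.2.2 then z.im else z.re) ((fundamentalRep (Fin 2) (V q.1) : Matrix (Fin 2) (Fin 2) ℂ) q.2.1 q.2.2.1)) V (ee, i, j, false) : ℝ) : ℂ) + (((fun (V : GaugeConfig 3 L (Matrix.specialUnitaryGroup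 (Fin 2) ℂ)) (q : Edge 3 L × Fin (fundamentalLatticeRep 2).N × Fin (fundamentalLatticeRep 2).N × Bool) => (fun z : ℂ => if q.2.2.2 then z.im else z.re) ((fundamentalRep (Fin 2) (V q.1) : Matrix (Fin 2) (Fin 2) ℂ) q.2.1 q.2.2.1)) V (ee, i, j, true) : ℝ) : ℂ) * Complex.I) q.1)) q.2.1 q.2.2.1) else 0)
        ≤ K₀ * ∑ n : Edge 3 L × NoiseIdx (fundamentalLatticeRep 2).N, (Λ (fun q : Edge 3 L × Fin (fundamentalLatticeRep 2).N × Fin (fundamentalLatticeRep 2).N × Bool => if n.1 = q.1 then (fun z : ℂ => if q.2.2.2 then z.im else z.re) (((Real.sqrt 2 : ℂ) • ((fundamentalLatticeRep 2).lieProj (noiseDir n.2) * (fun (ee : Edge 3 L) => Matrix.of fun (i j : Fin (fundamentalLatticeRep 2).N) => (((fun (V : GaugeConfig 3 L (Matrix.specialUnitaryGroup (Fin 2) ℂ)) (q : Edge 3 L × Fin (fundamentalLatticeRep 2).N × Fin (fundamentalLatticeRep 2).N × Bool) => (fun z : ℂ => if q.2.2.2 then z.im else z.re) ((fundamentalRep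 (Fin 2) (V q.1) : Matrix (Fin 2) (Fin 2) ℂ) q.2.1 q.2.2.1)) V (ee, i, j, false) : ℝ) : ℂ) + (((fun (V : GaugeConfig 3 L (Matrix.specialUnitaryGroup (Fin 2) ℂ)) (q : Edge 3 L × Fin (fundamentalLatticeRep 2).N × Fin (fundamentalLatticeRep 2).N × Bool) => (fun z : ℂ => if q.2.2.2 then z.im else z.re) ((fundamentalRep (Fin 2) (V q.1) : Matrix (Fin 2) (Fin 2) ℂ) q.2.1 q.2.2.1)) V (ee, i, j, true) : ℝ) : ℂ) * Complex.I) q.1)) q.2.1 q.2.2.1) else 0)) ^ 2))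
    (κ : ℝ≥0 → Kernel (GaugeConfig 3 L (Matrix.specialUnitaryGroup (Fin 2) ℂ))
      (GaugeConfig 3 L (Matrix.specialUnitaryGroup (Fin 2) ℂ))) [∀ t, IsMarkovKernel (κ t)]
    (hreal : ∀ (t : ℝ≥0) (x : GaugeConfig 3 L (Matrix.specialUnitaryGroup (Fin 2) ℂ))
        (Ω : Type) [MeasurableSpace Ω] (P : Measure Ω) [IsProbabilityMeasure P]
        (W : ℝ≥0 → Ω → (Edge 3 L × NoiseIdx 2 → ℝ)) (hW : IsFlatBrownian W P)
        (U : ℝ≥0 → Ω → GaugeConfig 3 L (Matrix.specialUnitaryGroup (Fin 2) ℂ)),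
        (∀ ω, U 0 ω = x) →
        (latticeLangevinDynamics (fundamentalLatticeRep 2) β').IsSolution (fundamentalRep (Fin 2))
          hW.natFiltration P W U →
        κ t x = P.map (U t))
    {f : (Edge 3 L × Fin 2 × Fin 2 × Bool → ℝ) → ℝ} (hf3 : ContDiff ℝ 3 f) (hfc : HasCompactSupport f)
    {a : (Edge 3 L × Fin 2 × Fin 2 × Bool → ℝ) → ℝ} (ha : ContDiff ℝ 3 a) (hac : HasCompactSupport a) (t : ℝ≥0)
    {g' : (Edge 3 L × Fin 2 × Fin 2 × Bool → ℝ) → ℝ} (hg' : ContDiff ℝ 1 g') :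
    let coords : GaugeConfig 3 L (Matrix.specialUnitaryGroup (Fin 2) ℂ) → (Edge 3 L × Fin 2 × Fin 2 × Bool → ℝ) :=
      fun V q => (fun z : ℂ => if q.2.2.2 then z.im else z.re)
        ((fundamentalRep (Fin 2) (V q.1) : Matrix (Fin 2) (Fin 2) ℂ) q.2.1 q.2.2.1)
    let A : GaugeConfig 3 L (Matrix.specialUnitaryGroup (Fin 2) ℂ) → (Edge 3 L × Fin 2 × Fin 2 × Bool) →
        (Edge 3 L × Fin 2 × Fin 2 × Bool) → ℝ := fun V i j =>
      ∑ n : Edge 3 L × NoiseIdx 2,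
        (if n.1 = i.1 then (fun z : ℂ => if i.2.2.2 then z.im else z.re)
          ((latticeLangevinDynamics (fundamentalLatticeRep 2) β').noise
            (matrixConfig (fundamentalRep (Fin 2)) V) i.1 n.2 i.2.1 i.2.2.1) else 0) *
        (if n.1 = j.1 then (fun z : ℂ => if j.2.2.2 then z.im else z.re)
          ((latticeLangevinDynamics (fundamentalLatticeRep 2) β').noise
            (matrixConfig (fundamentalRep (Fin 2)) V) j.1 n.2 j.2.1 j.2.2.1) else 0)
    let gen : ((Edge 3 L × Fin 2 × Fin 2 × Bool → ℝ) → ℝ) → GaugeConfig 3 L (Matrix.specialUnitaryGroup (Fin 2) ℂ) → ℝ :=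
      fun h V =>
      (∑ i : Edge 3 L × Fin 2 × Fin 2 × Bool, fderiv ℝ h (coords V) (Pi.single i 1) *
          (fun z : ℂ => if i.2.2.2 then z.im else z.re)
            ((latticeLangevinDynamics (fundamentalLatticeRep 2) β').drift
              (matrixConfig (fundamentalRep (Fin 2)) V) i.1 i.2.1 i.2.2.1) +
      1 / 2 * ∑ i : Edge 3 L × Fin 2 × Fin 2 × Bool, ∑ j : Edge 3 L × Fin 2 × Fin 2 × Bool,
        fderiv ℝ (fun z => fderiv ℝ h z (Pi.single i 1)) (coords V) (Pi.single j 1) *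
          ∑ n : Edge 3 L × NoiseIdx 2,
            (if n.1 = i.1 then (fun z : ℂ => if i.2.2.2 then z.im else z.re)
              ((latticeLangevinDynamics (fundamentalLatticeRep 2) β').noise
                (matrixConfig (fundamentalRep (Fin 2)) V) i.1 n.2 i.2.1 i.2.2.1) else 0) *
            (if n.1 = j.1 then (fun z : ℂ => if j.2.2.2 then z.im else z.re)
              ((latticeLangevinDynamics (fundamentalLatticeRep 2) β').noise
                (matrixConfig (fundamentalRep (Fin 2)) V) j.1 n.2 j.2.1 j.2.2.1) else 0))
    (∀ x, a (coords x) = gen f x) → (∀ x, ∫ y, f (coords y) ∂(κ t x) = g' (coords x)) →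
      ∀ x, Real.exp ((2 - K₀) * (t : ℝ)) * (∑ i : Edge 3 L × Fin 2 × Fin 2 × Bool, ∑ j : Edge 3 L × Fin 2 × Fin 2 × Bool, fderiv ℝ g' (coords x) (Pi.single i 1) * fderiv ℝ g' (coords x) (Pi.single j 1) * A x i j) ≤ ∫ y, (∑ i : Edge 3 L × Fin 2 × Fin 2 × Bool, ∑ j : Edge 3 L × Fin 2 × Fin 2 × Bool, fderiv ℝ f (coords y) (Pi.single i 1) * fderiv ℝ f (coords y) (Pi.single j 1) * A y i j) ∂(κ t x) := by
  intro coords A gen haf hg'rep x₀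
  classical
  haveI := secondCountableTopology_su2
  haveI := borelSpace_config L
  set μ : Measure (GaugeConfig 3 L (Matrix.specialUnitaryGroup (Fin 2) ℂ)) := (wilsonMeasure (d := 3) (L := L) (fundamentalRep (Fin 2)) β') with hμ
  haveI : IsProbabilityMeasure μ :=
    isProbabilityMeasure_wilsonMeasure (d := 3) (L := L) (fundamentalRep (Fin 2)) (continuous_fundamentalRep (Fin 2)) β'
  have hco : Continuous coords := continuous_coords (L := L)
  have hInt : ∀ {Φ : (GaugeConfig 3 L (Matrix.specialUnitaryGroup (Fin 2) ℂ)) → ℝ}, Continuous Φ → Integrable Φ μ := fun hΦ => integrable_of_continuous_of_compactSpace hΦ μ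
  have hf2 : ContDiff ℝ 2 f := hf3.of_le (by norm_num)
  -- §1 a `C³_c` representative `g` of `κ_t F`; its carré equals that of `g'` on the group
  obtain ⟨g, hg, hgc, hgrep⟩ := transitionKernel_preserves_dynkinClass L β' κ hreal t hf3
  have hgrep₁ : ∀ x : (GaugeConfig 3 L (Matrix.specialUnitaryGroup (Fin 2) ℂ)), ∫ y, f (coords y) ∂(κ t x) = g (coords x) := fun x => hgrep x
  have hΓeq : ∀ x : (GaugeConfig 3 L (Matrix.specialUnitaryGroup (Fin 2) ℂ)), (∑ i : Edge 3 L × Fin 2 × Fin 2 × Bool, ∑ j : Edge 3 L × Fin 2 × Fin 2 × Bool, fderiv ℝ g' (coords x) (Pi.single i 1) * fderiv ℝ g' (coords x) (Pi.single j 1) * A x i j) = (∑ i : Edge 3 L × Fin 2 × Fin 2 × Bool, ∑ j : Edge 3 L × Fin 2 × Fin 2 × Bool, fderiv ℝ g (coords x) (Pi.single i 1) * fderiv ℝ g (coords x) (Pi.single j 1) * A x i j) := by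
    intro x
    have heq : ∀ V : (GaugeConfig 3 L (Matrix.specialUnitaryGroup (Fin 2) ℂ)), g' (coords V) = g (coords V) := fun V => by rw [← hg'rep V, ← hgrep₁ V]
    have hW : ∀ n : Edge 3 L × NoiseIdx (fundamentalLatticeRep 2).N,
        fderiv ℝ g' (coords x) (fun q : Edge 3 L × Fin (fundamentalLatticeRep 2).N × Fin (fundamentalLatticeRep 2).N × Bool => if n.1 = q.1 then (fun z : ℂ => if q.2.2.2 then z.im else z.re) (((Real.sqrt 2 : ℂ) • ((fundamentalLatticeRep 2).lieProj (noiseDir n.2) * (fun (ee : Edge 3 L) => Matrix.of fun (i j : Fin (fundamentalLatticeRep 2).N) => ((coords x (ee, i, j, false) : ℝ) : ℂ) + ((coords x (ee, i, j, true) : ℝ) : ℂ) * Complex.I) q.1)) q.2.1 q.2.2.1) else 0) = fderiv ℝ g (coords x) (fun q : Edge 3 L × Fin (fundamentalLatticeRep 2).N × Fin (fundamentalLatticeRep 2).N × Bool => if n.1 = q.1 then (fun z : ℂ => if q.2.2.2 then z.im else z.re) (((Real.sqrt 2 : ℂ) • ((fundamentalLatticeRep 2).lieProj (noiseDir n.2)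 * (fun (ee : Edge 3 L) => Matrix.of fun (i j : Fin (fundamentalLatticeRep 2).N) => ((coords x (ee, i, j, false) : ℝ) : ℂ) + ((coords x (ee, i, j, true) : ℝ) : ℂ) * Complex.I) q.1)) q.2.1 q.2.2.1) else 0) := fun n =>
      frameDeriv_eq_of_comp_coords_eq (L := L) n (hg'.differentiable (by norm_num)) (hg.differentiable (by norm_num)) heq x
    have h1 : (∑ i : Edge 3 L × Fin 2 × Fin 2 × Bool, ∑ j : Edge 3 L × Fin 2 × Fin 2 × Bool, fderiv ℝ g' (coords x) (Pi.single i 1) * fderiv ℝ g' (coords x) (Pi.single j 1) * A x i j) =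
        ∑ n : Edge 3 L × NoiseIdx (fundamentalLatticeRep 2).N, fderiv ℝ g' (coords x) (fun q : Edge 3 L × Fin (fundamentalLatticeRep 2).N × Fin (fundamentalLatticeRep 2).N × Bool => if n.1 = q.1 then (fun z : ℂ => if q.2.2.2 then z.im else z.re) (((Real.sqrt 2 : ℂ) • ((fundamentalLatticeRep 2).lieProj (noiseDir n.2) * (fun (ee : Edge 3 L) => Matrix.of fun (i j : Fin (fundamentalLatticeRep 2).N) => ((coords x (ee, i, j, false) : ℝ) : ℂ) + ((coords x (ee, i, j, true) : ℝ) : ℂ) * Complex.I) q.1)) q.2.1 q.2.2.1) else 0) * fderiv ℝ g' (coords x) (fun q : Edge 3 L × Fin (fundamentalLatticeRep 2).N × Fin (fundamentalLatticeRep 2).N × Bool => if n.1 = q.1 then (fun z : ℂ => if q.2.2.2 then z.im else z.re) (((Real.sqrt 2 : ℂ) • ((fundamentalLatticeRep 2).lieProj (noiseDir n.2) * (fun (ee : Edge 3 L) => Matrix.of fun (i j : Fin (fundamentalLatticeRep 2).N) => ((coords x (ee, i, j, false) : ℝ) : ℂ) + ((coords x (ee, i, j, true) : ℝ) : ℂ)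 * Complex.I) q.1)) q.2.1 q.2.2.1) else 0) :=
      carre_eq_sum_frameDeriv_mul L β' g' g' x
    have h2 : (∑ i : Edge 3 L × Fin 2 × Fin 2 × Bool, ∑ j : Edge 3 L × Fin 2 × Fin 2 × Bool, fderiv ℝ g (coords x) (Pi.single i 1) * fderiv ℝ g (coords x) (Pi.single j 1) * A x i j) =
        ∑ n : Edge 3 L × NoiseIdx (fundamentalLatticeRep 2).N, fderiv ℝ g (coords x) (fun q : Edge 3 L × Fin (fundamentalLatticeRep 2).N × Fin (fundamentalLatticeRep 2).N × Bool => if n.1 = q.1 then (fun z : ℂ => if q.2.2.2 then z.im else z.re) (((Real.sqrt 2 : ℂ) • ((fundamentalLatticeRep 2).lieProj (noiseDir n.2) * (fun (ee : Edge 3 L) => Matrix.of fun (i j : Fin (fundamentalLatticeRep 2).N) => ((coords x (ee, i, j, false) : ℝ) : ℂ) + ((coords x (ee, i, j, true) : ℝ) : ℂ) * Complex.I) q.1)) q.2.1 q.2.2.1) else 0) * fderiv ℝ g (coords x) (fun q : Edge 3 L × Fin (fundamentalLatticeRep 2).N × Fin (fundamentalLatticeRep 2).N × Bool => if n.1 =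 q.1 then (fun z : ℂ => if q.2.2.2 then z.im else z.re) (((Real.sqrt 2 : ℂ) • ((fundamentalLatticeRep 2).lieProj (noiseDir n.2) * (fun (ee : Edge 3 L) => Matrix.of fun (i j : Fin (fundamentalLatticeRep 2).N) => ((coords x (ee, i, j, false) : ℝ) : ℂ) + ((coords x (ee, i, j, true) : ℝ) : ℂ) * Complex.I) q.1)) q.2.1 q.2.2.1) else 0) :=
      carre_eq_sum_frameDeriv_mul L β' g g x
    rw [h1, h2]
    exact Finset.sum_congr rfl fun n _ => by rw [hW n]
  rw [hΓeq x₀]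
  -- §2 the integrated bound for every admissible test function
  have hflow : ∀ (h : (Edge 3 L × Fin 2 × Fin 2 × Bool → ℝ) → ℝ), ContDiff ℝ 5 h → HasCompactSupport h → (∀ x : (GaugeConfig 3 L (Matrix.specialUnitaryGroup (Fin 2) ℂ)), 0 ≤ h (coords x)) →
      Real.exp ((2 - K₀) * (t : ℝ)) * ∫ x, h (coords x) * (∑ i : Edge 3 L × Fin 2 × Fin 2 × Bool, ∑ j : Edge 3 L × Fin 2 × Fin 2 × Bool, fderiv ℝ g (coords x) (Pi.single i 1) * fderiv ℝ g (coords x) (Pi.single j 1) * A x i j) ∂μ ≤ ∫ x, h (coords x) * (∫ y, (∑ i : Edge 3 L × Fin 2 × Fin 2 × Bool, ∑ j : Edge 3 L × Fin 2 × Fin 2 × Bool, fderiv ℝ f (coords y) (Pi.single i 1) * fderiv ℝ f (coords y) (Pi.single j 1) * A y i j) ∂(κ t x)) ∂μ :=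
    fun h hh hhc hh0 => integral_mul_carre_transition_le_of_generatorRep L β' K₀ hHess κ hreal hf3 hfc ha hac hh hhc t hg hgc haf hh0 hgrep₁
  -- §3 both sides are continuous ON THE GROUP
  have hleib : ∀ {φ : (Edge 3 L × Fin 2 × Fin 2 × Bool → ℝ) → ℝ}, ContDiff ℝ 2 φ → Continuous fun x : (GaugeConfig 3 L (Matrix.specialUnitaryGroup (Fin 2) ℂ)) => (∑ i : Edge 3 L × Fin 2 × Fin 2 × Bool, ∑ j : Edge 3 L × Fin 2 × Fin 2 × Bool, fderiv ℝ φ (coords x) (Pi.single i 1) * fderiv ℝ φ (coords x) (Pi.single j 1) * A x i j) := by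
    intro φ hφ
    have hl : ∀ x : (GaugeConfig 3 L (Matrix.specialUnitaryGroup (Fin 2) ℂ)), gen (fun z => φ z * φ z) x = φ (coords x) * gen φ x + φ (coords x) * gen φ x + (∑ i : Edge 3 L × Fin 2 × Fin 2 × Bool, ∑ j : Edge 3 L × Fin 2 × Fin 2 × Bool, fderiv ℝ φ (coords x) (Pi.single i 1) * fderiv ℝ φ (coords x) (Pi.single j 1) * A x i j) :=
      fun x => generator_mul_coords L β' hφ hφ x
    have e : (fun x : (GaugeConfig 3 L (Matrix.specialUnitaryGroup (Fin 2) ℂ)) => (∑ i : Edge 3 L × Fin 2 × Fin 2 × Bool, ∑ j : Edge 3 L × Fin 2 × Fin 2 × Bool, fderiv ℝ φ (coords x) (Pi.single i 1) * fderiv ℝ φ (coords x) (Pi.single j 1) * A x i j)) = fun x => gen (fun z => φ z * φ z) x - (φ (coords x) * gen φ x + φ (coords x) * gen φ x) := by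
      funext x; rw [hl x]; ring
    rw [e]
    have cφ : Continuous fun x : (GaugeConfig 3 L (Matrix.specialUnitaryGroup (Fin 2) ℂ)) => φ (coords x) := hφ.continuous.comp hco
    exact (continuous_generator (L := L) β' ((hφ.mul hφ).of_le (by norm_num))).sub
      ((cφ.mul (continuous_generator (L := L) β' hφ)).add (cφ.mul (continuous_generator (L := L) β' hφ)))
  have cΓg : Continuous fun x : (GaugeConfig 3 L (Matrix.specialUnitaryGroup (Fin 2) ℂ)) => (∑ i : Edge 3 L × Fin 2 × Fin 2 × Bool, ∑ j : Edge 3 L × Fin 2 × Fin 2 × Bool, fderiv ℝ g (coords x) (Pi.single i 1) * fderiv ℝ g (coords x) (Pi.single j 1) * A x i j) := hleib (hg.of_le (by norm_num))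
  have cΓf : Continuous fun x : (GaugeConfig 3 L (Matrix.specialUnitaryGroup (Fin 2) ℂ)) => (∑ i : Edge 3 L × Fin 2 × Fin 2 × Bool, ∑ j : Edge 3 L × Fin 2 × Fin 2 × Bool, fderiv ℝ f (coords x) (Pi.single i 1) * fderiv ℝ f (coords x) (Pi.single j 1) * A x i j) := hleib hf2
  have cR : Continuous fun x : (GaugeConfig 3 L (Matrix.specialUnitaryGroup (Fin 2) ℂ)) => ∫ y, (∑ i : Edge 3 L × Fin 2 × Fin 2 × Bool, ∑ j : Edge 3 L × Fin 2 × Fin 2 × Bool, fderiv ℝ f (coords y) (Pi.single i 1) * fderiv ℝ f (coords y) (Pi.single j 1) * A y i j) ∂(κ t x) := continuous_integral_transitionKernel L β' κ hreal t cΓf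
  set φ : (GaugeConfig 3 L (Matrix.specialUnitaryGroup (Fin 2) ℂ)) → ℝ := fun x => Real.exp ((2 - K₀) * (t : ℝ)) * (∑ i : Edge 3 L × Fin 2 × Fin 2 × Bool, ∑ j : Edge 3 L × Fin 2 × Fin 2 × Bool, fderiv ℝ g (coords x) (Pi.single i 1) * fderiv ℝ g (coords x) (Pi.single j 1) * A x i j) - ∫ y, (∑ i : Edge 3 L × Fin 2 × Fin 2 × Bool, ∑ j : Edge 3 L × Fin 2 × Fin 2 × Bool, fderiv ℝ f (coords y) (Pi.single i 1) * fderiv ℝ f (coords y) (Pi.single j 1) * A y i j) ∂(κ t x) with hφ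
  have hφc : Continuous φ := (continuous_const.mul cΓg).sub cR
  -- §4 suppose the bound fails at `x₀`: `φ x₀ > 0`, hence `φ > 0` on the preimage of a small coordinate ball (closed embedding)
  by_contra hlt
  rw [not_le] at hlt
  have hφ0 : 0 < φ x₀ := by rw [hφ]; simp only []; linarith
  have hU : {x : (GaugeConfig 3 L (Matrix.specialUnitaryGroup (Fin 2) ℂ)) | 0 < φ x} ∈ 𝓝 x₀ := (isOpen_lt continuous_const hφc).mem_nhds hφ0
  have hce := isClosedEmbedding_coords L
  have hnhds : 𝓝 x₀ = Filter.comap coords (𝓝 (coords x₀)) := hce.toIsEmbedding.toIsInducing.nhds_eq_comap x₀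
  rw [hnhds, Filter.mem_comap] at hU
  obtain ⟨V', hV', hV'U⟩ := hU
  obtain ⟨ε, hε, hballV'⟩ := Metric.mem_nhds_iff.1 hV'
  have hball : ∀ x : (GaugeConfig 3 L (Matrix.specialUnitaryGroup (Fin 2) ℂ)), coords x ∈ ball (coords x₀) ε → 0 < φ x := fun x hx => hV'U (hballV' hx)
  let χ : ContDiffBump (coords x₀) := ⟨ε / 4, ε / 2, by positivity, by linarith⟩
  have hχ5 : ContDiff ℝ 5 (χ : (Edge 3 L × Fin 2 × Fin 2 × Bool → ℝ) → ℝ) := χ.contDiff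
  have hχ0 : ∀ x : (GaugeConfig 3 L (Matrix.specialUnitaryGroup (Fin 2) ℂ)), 0 ≤ (χ : (Edge 3 L × Fin 2 × Fin 2 × Bool → ℝ) → ℝ) (coords x) := fun x => χ.nonneg
  have hprod0 : ∀ x : (GaugeConfig 3 L (Matrix.specialUnitaryGroup (Fin 2) ℂ)), 0 ≤ (χ : (Edge 3 L × Fin 2 × Fin 2 × Bool → ℝ) → ℝ) (coords x) * φ x := by
    intro x
    by_cases hz : (χ : (Edge 3 L × Fin 2 × Fin 2 × Bool → ℝ) → ℝ) (coords x) = 0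
    · rw [hz, zero_mul]
    · have hmem : coords x ∈ Function.support (χ : (Edge 3 L × Fin 2 × Fin 2 × Bool → ℝ) → ℝ) := hz
      rw [χ.support_eq] at hmem
      have hin : coords x ∈ ball (coords x₀) ε := ball_subset_ball (by show χ.rOut ≤ ε; simp only [χ]; linarith) hmem
      exact mul_nonneg χ.nonneg (le_of_lt (hball x hin))
  have hpos0 : 0 < (χ : (Edge 3 L × Fin 2 × Fin 2 × Bool → ℝ) → ℝ) (coords x₀) * φ x₀ := by
    rw [χ.one_of_mem_closedBall (mem_closedBall_self (by show (0 : ℝ) ≤ χ.rIn; simp only [χ]; positivity)), one_mul]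
    exact hφ0
  have cP : Continuous fun x : (GaugeConfig 3 L (Matrix.specialUnitaryGroup (Fin 2) ℂ)) => (χ : (Edge 3 L × Fin 2 × Fin 2 × Bool → ℝ) → ℝ) (coords x) * φ x := (χ.continuous.comp hco).mul hφc
  -- positivity of `μ_(β')` on nonempty open sets
  set π : Measure (GaugeConfig 3 L (Matrix.specialUnitaryGroup (Fin 2) ℂ)) := Measure.pi fun _ : Edge 3 L => haarProbability (Matrix.specialUnitaryGroup (Fin 2) ℂ) with hπ
  haveI : π.IsOpenPosMeasure := by
    rw [hπ]
    haveI : ∀ _e : Edge 3 L, (haarProbability (Matrix.specialUnitaryGroup (Fin 2) ℂ)).IsOpenPosMeasure := fun _ => by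
      unfold haarProbability; infer_instance
    infer_instance
  have hπμ : π ≪ μ := by
    rw [hμ, Literature.MathematicalPhysics.QuantumLattice.wilsonMeasure_eq_tilted_pi (fundamentalRep (Fin 2))
      (continuous_fundamentalRep (n := Fin 2)) β', ← hπ]
    refine absolutelyContinuous_tilted ?_
    obtain ⟨B, hB⟩ := exists_abs_wilsonAction_le (d := 3) (L := L) (fundamentalRep (Fin 2)) (continuous_fundamentalRep (Fin 2))
    refine Integrable.of_bound (((measurable_wilsonAction (d := 3) (L := L) (fundamentalRep (Fin 2)) (continuous_fundamentalRep (Fin 2))).const_mul _).exp).aestronglyMeasurable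
      (Real.exp (|β'| * B)) (ae_of_all _ fun U => ?_)
    rw [Real.norm_eq_abs, Real.abs_exp, Real.exp_le_exp]
    have h1 : |β' * wilsonAction (fundamentalRep (Fin 2)) U| ≤ |β'| * B := by
      rw [abs_mul]; exact mul_le_mul_of_nonneg_left (hB U) (abs_nonneg _)
    have h2 := (abs_le.1 h1).1
    linarith
  have hIpos : 0 < ∫ x, (χ : (Edge 3 L × Fin 2 × Fin 2 × Bool → ℝ) → ℝ) (coords x) * φ x ∂μ := by
    rw [integral_pos_iff_support_of_nonneg (fun x => hprod0 x) (hInt cP)]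
    have hO : IsOpen {x : (GaugeConfig 3 L (Matrix.specialUnitaryGroup (Fin 2) ℂ)) | 0 < (χ : (Edge 3 L × Fin 2 × Fin 2 × Bool → ℝ) → ℝ) (coords x) * φ x} := isOpen_lt continuous_const cP
    have hOπ : 0 < π {x : (GaugeConfig 3 L (Matrix.specialUnitaryGroup (Fin 2) ℂ)) | 0 < (χ : (Edge 3 L × Fin 2 × Fin 2 × Bool → ℝ) → ℝ) (coords x) * φ x} := hO.measure_pos π ⟨x₀, hpos0⟩
    have hOμ : 0 < μ {x : (GaugeConfig 3 L (Matrix.specialUnitaryGroup (Fin 2) ℂ)) | 0 < (χ : (Edge 3 L × Fin 2 × Fin 2 × Bool → ℝ) → ℝ) (coords x) * φ x} :=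
      pos_iff_ne_zero.2 fun h0 => hOπ.ne' (hπμ h0)
    exact hOμ.trans_le (measure_mono fun x hx => ne_of_gt hx)
  -- but the integrated bound says this integral is `≤ 0`
  have hle : ∫ x, (χ : (Edge 3 L × Fin 2 × Fin 2 × Bool → ℝ) → ℝ) (coords x) * φ x ∂μ ≤ 0 := by
    have h1 := hflow χ hχ5 χ.hasCompactSupport hχ0
    have cχ : Continuous fun x : (GaugeConfig 3 L (Matrix.specialUnitaryGroup (Fin 2) ℂ)) => (χ : (Edge 3 L × Fin 2 × Fin 2 × Bool → ℝ) → ℝ) (coords x) := χ.continuous.comp hco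
    have i1 : Integrable (fun x => Real.exp ((2 - K₀) * (t : ℝ)) * ((χ : (Edge 3 L × Fin 2 × Fin 2 × Bool → ℝ) → ℝ) (coords x) * (∑ i : Edge 3 L × Fin 2 × Fin 2 × Bool, ∑ j : Edge 3 L × Fin 2 × Fin 2 × Bool, fderiv ℝ g (coords x) (Pi.single i 1) * fderiv ℝ g (coords x) (Pi.single j 1) * A x i j))) μ := (hInt (cχ.mul cΓg)).const_mul _
    have i2 : Integrable (fun x => (χ : (Edge 3 L × Fin 2 × Fin 2 × Bool → ℝ) → ℝ) (coords x) * (∫ y, (∑ i : Edge 3 L × Fin 2 × Fin 2 × Bool, ∑ j : Edge 3 L × Fin 2 × Fin 2 × Bool, fderiv ℝ f (coords y) (Pi.single i 1) * fderiv ℝ f (coords y) (Pi.single j 1) * A y i j) ∂(κ t x))) μ := hInt (cχ.mul cR)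
    have e : ∫ x, (χ : (Edge 3 L × Fin 2 × Fin 2 × Bool → ℝ) → ℝ) (coords x) * φ x ∂μ =
        Real.exp ((2 - K₀) * (t : ℝ)) * ∫ x, (χ : (Edge 3 L × Fin 2 × Fin 2 × Bool → ℝ) → ℝ) (coords x) * (∑ i : Edge 3 L × Fin 2 × Fin 2 × Bool, ∑ j : Edge 3 L × Fin 2 × Fin 2 × Bool, fderiv ℝ g (coords x) (Pi.single i 1) * fderiv ℝ g (coords x) (Pi.single j 1) * A x i j) ∂μ -
          ∫ x, (χ : (Edge 3 L × Fin 2 × Fin 2 × Bool → ℝ) → ℝ) (coords x) * (∫ y, (∑ i : Edge 3 L × Fin 2 × Fin 2 × Bool, ∑ j : Edge 3 L × Fin 2 × Fin 2 × Bool, fderiv ℝ f (coords y) (Pi.single i 1) * fderiv ℝ f (coords y) (Pi.single j 1) * A y i j) ∂(κ t x)) ∂μ := by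
      rw [← integral_const_mul, ← integral_sub i1 i2]
      refine integral_congr_ae (ae_of_all _ fun x => ?_)
      show (χ : (Edge 3 L × Fin 2 × Fin 2 × Bool → ℝ) → ℝ) (coords x) * φ x = _
      rw [hφ]; ring
    rw [e]; linarith
  exact absurd hle (not_le.2 hIpos)

/-- ★★★ **Exponential decay of the Lipschitz seminorm for BOUNDED smooth observables, uniform in the volume.**  At `|β'| < 1/12`
(`c = 2(1 − 12|β'|)`): for every `L`, realising kernel family `κ`, `C⁵` `f₀` with `|f₀∘coords| ≤ M` on the group, lattice times `t > 0`
and `s ≥ 0`, and any `C¹` `g` with `κ_(t+s)(f₀∘coords) = g∘coords`:  `Γ^A(g)(x) ≤ e^(−cs)·(c/(e^(ct) − 1))·M²` at every `x`.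
[cite: BakryGentilLedoux2014, Thm 3.2.3 and Thm 4.7.2 (iii)] -/
theorem wilson_lipschitz_decay_of_bounded_uniform (L : ℕ) [NeZero L] (β' : ℝ) (hβ : |β'| < 1 / 12)
    (κ : ℝ≥0 → Kernel (GaugeConfig 3 L (Matrix.specialUnitaryGroup (Fin 2) ℂ))
      (GaugeConfig 3 L (Matrix.specialUnitaryGroup (Fin 2) ℂ))) [∀ t, IsMarkovKernel (κ t)]
    (hreal : ∀ (t : ℝ≥0) (x : GaugeConfig 3 L (Matrix.specialUnitaryGroup (Fin 2) ℂ))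
        (Ω : Type) [MeasurableSpace Ω] (P : Measure Ω) [IsProbabilityMeasure P]
        (W : ℝ≥0 → Ω → (Edge 3 L × NoiseIdx 2 → ℝ)) (hW : IsFlatBrownian W P)
        (U : ℝ≥0 → Ω → GaugeConfig 3 L (Matrix.specialUnitaryGroup (Fin 2) ℂ)),
        (∀ ω, U 0 ω = x) →
        (latticeLangevinDynamics (fundamentalLatticeRep 2) β').IsSolution (fundamentalRep (Fin 2))
          hW.natFiltration P W U →
        κ t x = P.map (U t))
    {f₀ : (Edge 3 L × Fin 2 × Fin 2 × Bool → ℝ) → ℝ} (hf₀ : ContDiff ℝ 5 f₀) {M : ℝ} {t : ℝ≥0} (ht : 0 < (t : ℝ)) (s : ℝ≥0)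
    {g : (Edge 3 L × Fin 2 × Fin 2 × Bool → ℝ) → ℝ} (hg : ContDiff ℝ 1 g) :
    let coords : GaugeConfig 3 L (Matrix.specialUnitaryGroup (Fin 2) ℂ) → (Edge 3 L × Fin 2 × Fin 2 × Bool → ℝ) :=
      fun V q => (fun z : ℂ => if q.2.2.2 then z.im else z.re)
        ((fundamentalRep (Fin 2) (V q.1) : Matrix (Fin 2) (Fin 2) ℂ) q.2.1 q.2.2.1)
    let A : GaugeConfig 3 L (Matrix.specialUnitaryGroup (Fin 2) ℂ) → (Edge 3 L × Fin 2 × Fin 2 × Bool) →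
        (Edge 3 L × Fin 2 × Fin 2 × Bool) → ℝ := fun V i j =>
      ∑ n : Edge 3 L × NoiseIdx 2,
        (if n.1 = i.1 then (fun z : ℂ => if i.2.2.2 then z.im else z.re)
          ((latticeLangevinDynamics (fundamentalLatticeRep 2) β').noise
            (matrixConfig (fundamentalRep (Fin 2)) V) i.1 n.2 i.2.1 i.2.2.1) else 0) *
        (if n.1 = j.1 then (fun z : ℂ => if j.2.2.2 then z.im else z.re)
          ((latticeLangevinDynamics (fundamentalLatticeRep 2) β').noise
            (matrixConfig (fundamentalRep (Fin 2)) V) j.1 n.2 j.2.1 j.2.2.1) else 0)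
    (∀ y, |f₀ (coords y)| ≤ M) → (∀ x, ∫ y, f₀ (coords y) ∂(κ (t + s) x) = g (coords x)) →
      ∀ x, (∑ i : Edge 3 L × Fin 2 × Fin 2 × Bool, ∑ j : Edge 3 L × Fin 2 × Fin 2 × Bool, fderiv ℝ g (coords x) (Pi.single i 1) * fderiv ℝ g (coords x) (Pi.single j 1) * A x i j) ≤ Real.exp (-(2 * (1 - 12 * |β'|) * (s : ℝ))) *
        ((2 * (1 - 12 * |β'|)) / (Real.exp (2 * (1 - 12 * |β'|) * (t : ℝ)) - 1) * M ^ 2) := by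
  intro coords A hM hgrep x
  classical
  haveI := secondCountableTopology_su2
  haveI := borelSpace_config L
  have hco : Continuous coords := continuous_coords (L := L)
  -- the coordinate generator
  set gen : ((Edge 3 L × Fin 2 × Fin 2 × Bool → ℝ) → ℝ) → (GaugeConfig 3 L (Matrix.specialUnitaryGroup (Fin 2) ℂ)) → ℝ := fun φ V =>
      (∑ i : Edge 3 L × Fin 2 × Fin 2 × Bool, fderiv ℝ φ (coords V) (Pi.single i 1) *
          (fun z : ℂ => if i.2.2.2 then z.im else z.re)
            ((latticeLangevinDynamics (fundamentalLatticeRep 2) β').drift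
              (matrixConfig (fundamentalRep (Fin 2)) V) i.1 i.2.1 i.2.2.1) +
      1 / 2 * ∑ i : Edge 3 L × Fin 2 × Fin 2 × Bool, ∑ j : Edge 3 L × Fin 2 × Fin 2 × Bool,
        fderiv ℝ (fun z => fderiv ℝ φ z (Pi.single i 1)) (coords V) (Pi.single j 1) * A V i j) with hgen_def
  -- §1 smoothing at time `t`: the representative `u` of `κ_t F₀` with `Γ^A(u) ≤ (c/(e^(ct)−1))·M²`
  obtain ⟨u, hu, huc, hurep, hub⟩ := wilson_lipschitz_smoothing_uniform L β' hβ κ hreal hf₀ ht hM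
  -- §2 a `C³_c` representative of `𝓛u`: cut off `f₀`, take `a₀` = frame form of `𝓛f₁`, evolve it to time `t`
  obtain ⟨f₁, hf₁, hf₁c, hf₁eq⟩ := exists_contDiff_hasCompactSupport_eqOn (n := 5) hf₀ 1
  have hnear : ∀ y : (GaugeConfig 3 L (Matrix.specialUnitaryGroup (Fin 2) ℂ)), f₁ =ᶠ[𝓝 (coords y)] f₀ := fun y => hf₁eq _ (norm_coords_le_one y)
  have hval : ∀ y : (GaugeConfig 3 L (Matrix.specialUnitaryGroup (Fin 2) ℂ)), f₁ (coords y) = f₀ (coords y) := fun y => (hnear y).self_of_nhds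
  have hf₁3 : ContDiff ℝ 3 f₁ := hf₁.of_le (by norm_num)
  obtain ⟨s2, c, hs, -, -, -, hCas⟩ := exists_noiseFrame L
  have hψ4 : ContDiff ℝ 4 (fun y : (Edge 3 L × Fin 2 × Fin 2 × Bool → ℝ) => β' * ∑ p : Plaquette 3 L, (rootedLoop (fun (ee : Edge 3 L) (i j : Fin 2) => ((y (ee, i, j, false) : ℝ) : ℂ) + ((y (ee, i, j, true) : ℝ) : ℂ) * Complex.I) (p.1, p.2.1.1) p.2.1.2 false).trace.re) := contDiff_psiHat (d := 3) (L := L) (N := (fundamentalLatticeRep 2).N) β'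
  obtain ⟨a, ha, hac, haf⟩ : ∃ a : (Edge 3 L × Fin 2 × Fin 2 × Bool → ℝ) → ℝ, ContDiff ℝ 3 a ∧ HasCompactSupport a ∧ ∀ x : (GaugeConfig 3 L (Matrix.specialUnitaryGroup (Fin 2) ℂ)), a (coords x) = gen f₁ x := by
    set a₀ : (Edge 3 L × Fin 2 × Fin 2 × Bool → ℝ) → ℝ := fun z => 1 / 2 * ∑ n : Edge 3 L × NoiseIdx (fundamentalLatticeRep 2).N,
      (fderiv ℝ (fun w => fderiv ℝ f₁ w (s2 n w)) z (s2 n z) + fderiv ℝ (fun y : (Edge 3 L × Fin 2 × Fin 2 × Bool → ℝ) => β' * ∑ p : Plaquette 3 L, (rootedLoop (fun (ee : Edge 3 L) (i j : Fin 2) => ((y (ee, i, j, false) : ℝ) : ℂ) + ((y (ee, i, j, true) : ℝ) : ℂ) * Complex.I) (p.1, p.2.1.1) p.2.1.2 false).trace.re) z (s2 n z) * fderiv ℝ f₁ z (s2 n z)) with ha₀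
    have ha₀C : ContDiff ℝ 3 a₀ := contDiff_const.mul (contDiff_frameGen (k := 3) hf₁ hψ4 s2)
    obtain ⟨a, ha, hac, hanear⟩ := exists_contDiff_hasCompactSupport_eqOn (n := 3) ha₀C 1
    refine ⟨a, ha, hac, fun x => ?_⟩
    have h1 : a (coords x) = a₀ (coords x) := (hanear _ (norm_coords_le_one x)).self_of_nhds
    rw [h1, ha₀]
    exact (generator_eq_half_frameGen L β' s2 hs hCas f₁ (hf₁.of_le (by norm_num)) x).symm
  -- representatives at time `t`: `uF` of `κ_t F₁ (= κ_t F₀)` and `uA` of `κ_t(𝓛F₁) = 𝓛 uF`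
  obtain ⟨uF, huF, huFc, huFrep, huFcomm, -⟩ := transitionKernel_backwardKolmogorov (L := L) β' κ hreal hf₁3 hf₁c t
  obtain ⟨uA, huA, huAc, huArep, -, -⟩ := transitionKernel_backwardKolmogorov (L := L) β' κ hreal ha hac t
  have huFrep' : ∀ x : (GaugeConfig 3 L (Matrix.specialUnitaryGroup (Fin 2) ℂ)), ∫ y, f₁ (coords y) ∂(κ t x) = uF (coords x) := fun x => huFrep x
  have huArep' : ∀ x : (GaugeConfig 3 L (Matrix.specialUnitaryGroup (Fin 2) ℂ)), ∫ y, a (coords y) ∂(κ t x) = uA (coords x) := fun x => huArep x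
  have huFcomm' : ∀ x : (GaugeConfig 3 L (Matrix.specialUnitaryGroup (Fin 2) ℂ)), gen uF x = ∫ y, gen f₁ y ∂(κ t x) := fun x => huFcomm x
  have hAA : ∀ x : (GaugeConfig 3 L (Matrix.specialUnitaryGroup (Fin 2) ℂ)), uA (coords x) = gen uF x := fun x => by
    rw [← huArep' x, huFcomm' x]
    exact integral_congr_ae (ae_of_all _ fun y => haf y)
  -- Chapman–Kolmogorov: `κ_s(uF∘coords) = κ_(t+s) F₀ = g∘coords`
  have cF : Continuous fun y : (GaugeConfig 3 L (Matrix.specialUnitaryGroup (Fin 2) ℂ)) => f₁ (coords y) := hf₁.continuous.comp hco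
  have hCK : ∀ x : (GaugeConfig 3 L (Matrix.specialUnitaryGroup (Fin 2) ℂ)), ∫ y, uF (coords y) ∂(κ s x) = g (coords x) := by
    intro x
    rw [← hgrep x, add_comm, chapmanKolmogorov_szz β' κ hreal s t]
    haveI : IsProbabilityMeasure ((κ t ∘ₖ κ s) x) := by rw [← chapmanKolmogorov_szz β' κ hreal s t]; infer_instance
    have cF0 : Continuous fun y : (GaugeConfig 3 L (Matrix.specialUnitaryGroup (Fin 2) ℂ)) => f₀ (coords y) := hf₀.continuous.comp hco
    rw [Kernel.integral_comp (cF0.integrable_of_hasCompactSupport (HasCompactSupport.of_compactSpace _))]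
    refine integral_congr_ae (ae_of_all _ fun z => ?_)
    show uF (coords z) = ∫ y, f₀ (coords y) ∂(κ t z)
    rw [← huFrep' z]
    exact integral_congr_ae (ae_of_all _ fun y => hval y)
  -- §3 contraction from `t` to `t + s` for the `C³` data `uF` (generator representative `uA`)
  have h1 := wilson_carre_transition_le_of_generatorRep L β' (24 * |β'|) (wilson_hessBound L β') κ hreal huF huFc huA huAc s hg hAA hCK x
  have e : (2 - 24 * |β'| : ℝ) = 2 * (1 - 12 * |β'|) := by ring
  rw [e] at h1
  -- §4 `κ_s(Γ^A uF) ≤ sup Γ^A(uF) = sup Γ^A(u) ≤ (c/(e^(ct)−1))·M²`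
  haveI : IsProbabilityMeasure (κ s x) := IsMarkovKernel.isProbabilityMeasure x
  have hΓu : ∀ y : (GaugeConfig 3 L (Matrix.specialUnitaryGroup (Fin 2) ℂ)), (∑ i : Edge 3 L × Fin 2 × Fin 2 × Bool, ∑ j : Edge 3 L × Fin 2 × Fin 2 × Bool, fderiv ℝ uF (coords y) (Pi.single i 1) * fderiv ℝ uF (coords y) (Pi.single j 1) * A y i j) = (∑ i : Edge 3 L × Fin 2 × Fin 2 × Bool, ∑ j : Edge 3 L × Fin 2 × Fin 2 × Bool, fderiv ℝ u (coords y) (Pi.single i 1) * fderiv ℝ u (coords y) (Pi.single j 1) * A y i j) := by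
    intro y
    have heq : ∀ V : (GaugeConfig 3 L (Matrix.specialUnitaryGroup (Fin 2) ℂ)), uF (coords V) = u (coords V) := fun V => by
      rw [← huFrep' V, ← hurep V]
      exact integral_congr_ae (ae_of_all _ fun z => hval z)
    have hW : ∀ n : Edge 3 L × NoiseIdx (fundamentalLatticeRep 2).N,
        fderiv ℝ uF (coords y) (fun q : Edge 3 L × Fin (fundamentalLatticeRep 2).N × Fin (fundamentalLatticeRep 2).N × Bool => if n.1 = q.1 then (fun z : ℂ => if q.2.2.2 then z.im else z.re) (((Real.sqrt 2 : ℂ) • ((fundamentalLatticeRep 2).lieProj (noiseDir n.2) * (fun (ee : Edge 3 L) => Matrix.of fun (i j : Fin (fundamentalLatticeRep 2).N) => ((coords y (ee, i, j, false) : ℝ) : ℂ) + ((coords y (ee, i, j, true) : ℝ) : ℂ) * Complex.I) q.1)) q.2.1 q.2.2.1) else 0) = fderiv ℝ u (coords y) (fun q : Edge 3 L × Fin (fundamentalLatticeRep 2).N × Fin (fundamentalLatticeRep 2).N × Bool => if n.1 = q.1 then (fun z : ℂ => if q.2.2.2 then z.im else z.re) (((Real.sqrt 2 : ℂ) • ((fundamentalLatticeRep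 2).lieProj (noiseDir n.2) * (fun (ee : Edge 3 L) => Matrix.of fun (i j : Fin (fundamentalLatticeRep 2).N) => ((coords y (ee, i, j, false) : ℝ) : ℂ) + ((coords y (ee, i, j, true) : ℝ) : ℂ) * Complex.I) q.1)) q.2.1 q.2.2.1) else 0) := fun n =>
      frameDeriv_eq_of_comp_coords_eq (L := L) n (huF.differentiable (by norm_num)) (hu.differentiable (by norm_num)) heq y
    have e1 : (∑ i : Edge 3 L × Fin 2 × Fin 2 × Bool, ∑ j : Edge 3 L × Fin 2 × Fin 2 × Bool, fderiv ℝ uF (coords y) (Pi.single i 1) * fderiv ℝ uF (coords y) (Pi.single j 1) * A y i j) =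
        ∑ n : Edge 3 L × NoiseIdx (fundamentalLatticeRep 2).N, fderiv ℝ uF (coords y) (fun q : Edge 3 L × Fin (fundamentalLatticeRep 2).N × Fin (fundamentalLatticeRep 2).N × Bool => if n.1 = q.1 then (fun z : ℂ => if q.2.2.2 then z.im else z.re) (((Real.sqrt 2 : ℂ) • ((fundamentalLatticeRep 2).lieProj (noiseDir n.2) * (fun (ee : Edge 3 L) => Matrix.of fun (i j : Fin (fundamentalLatticeRep 2).N) => ((coords y (ee, i, j, false) : ℝ) : ℂ) + ((coords y (ee, i, j, true) : ℝ) : ℂ) * Complex.I) q.1)) q.2.1 q.2.2.1) else 0) * fderiv ℝ uF (coords y) (fun q : Edge 3 L × Fin (fundamentalLatticeRep 2).N × Fin (fundamentalLatticeRep 2).N × Bool => if n.1 = q.1 then (fun z : ℂ => if q.2.2.2 then z.im else z.re) (((Real.sqrt 2 : ℂ) • ((fundamentalLatticeRep 2).lieProj (noiseDir n.2) * (fun (ee : Edge 3 L) => Matrix.of fun (i j : Fin (fundamentalLatticeRep 2).N) => ((coords y (ee, i, j, false) : ℝ) : ℂ) + ((coords y (ee, i, j, true) : ℝ) : ℂ)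 * Complex.I) q.1)) q.2.1 q.2.2.1) else 0) :=
      carre_eq_sum_frameDeriv_mul L β' uF uF y
    have e2 : (∑ i : Edge 3 L × Fin 2 × Fin 2 × Bool, ∑ j : Edge 3 L × Fin 2 × Fin 2 × Bool, fderiv ℝ u (coords y) (Pi.single i 1) * fderiv ℝ u (coords y) (Pi.single j 1) * A y i j) =
        ∑ n : Edge 3 L × NoiseIdx (fundamentalLatticeRep 2).N, fderiv ℝ u (coords y) (fun q : Edge 3 L × Fin (fundamentalLatticeRep 2).N × Fin (fundamentalLatticeRep 2).N × Bool => if n.1 = q.1 then (fun z : ℂ => if q.2.2.2 then z.im else z.re) (((Real.sqrt 2 : ℂ) • ((fundamentalLatticeRep 2).lieProj (noiseDir n.2) * (fun (ee : Edge 3 L) => Matrix.of fun (i j : Fin (fundamentalLatticeRep 2).N) => ((coords y (ee, i, j, false) : ℝ) : ℂ) + ((coords y (ee, i, j, true) : ℝ) : ℂ) * Complex.I) q.1)) q.2.1 q.2.2.1) else 0) * fderiv ℝ u (coords y) (fun q : Edge 3 L × Fin (fundamentalLatticeRep 2).N × Fin (fundamentalLatticeRep 2).N × Bool => if n.1 =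 q.1 then (fun z : ℂ => if q.2.2.2 then z.im else z.re) (((Real.sqrt 2 : ℂ) • ((fundamentalLatticeRep 2).lieProj (noiseDir n.2) * (fun (ee : Edge 3 L) => Matrix.of fun (i j : Fin (fundamentalLatticeRep 2).N) => ((coords y (ee, i, j, false) : ℝ) : ℂ) + ((coords y (ee, i, j, true) : ℝ) : ℂ) * Complex.I) q.1)) q.2.1 q.2.2.1) else 0) :=
      carre_eq_sum_frameDeriv_mul L β' u u y
    rw [e1, e2]
    exact Finset.sum_congr rfl fun n _ => by rw [hW n]
  set B : ℝ := (2 * (1 - 12 * |β'|)) / (Real.exp (2 * (1 - 12 * |β'|) * (t : ℝ)) - 1) * M ^ 2 with hB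
  have hΓu0 : ∀ y : (GaugeConfig 3 L (Matrix.specialUnitaryGroup (Fin 2) ℂ)), 0 ≤ (∑ i : Edge 3 L × Fin 2 × Fin 2 × Bool, ∑ j : Edge 3 L × Fin 2 × Fin 2 × Bool, fderiv ℝ uF (coords y) (Pi.single i 1) * fderiv ℝ uF (coords y) (Pi.single j 1) * A y i j) := by
    intro y
    have e1 : (∑ i : Edge 3 L × Fin 2 × Fin 2 × Bool, ∑ j : Edge 3 L × Fin 2 × Fin 2 × Bool, fderiv ℝ uF (coords y) (Pi.single i 1) * fderiv ℝ uF (coords y) (Pi.single j 1) * A y i j) =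
        ∑ n : Edge 3 L × NoiseIdx (fundamentalLatticeRep 2).N, fderiv ℝ uF (coords y) (fun q : Edge 3 L × Fin (fundamentalLatticeRep 2).N × Fin (fundamentalLatticeRep 2).N × Bool => if n.1 = q.1 then (fun z : ℂ => if q.2.2.2 then z.im else z.re) (((Real.sqrt 2 : ℂ) • ((fundamentalLatticeRep 2).lieProj (noiseDir n.2) * (fun (ee : Edge 3 L) => Matrix.of fun (i j : Fin (fundamentalLatticeRep 2).N) => ((coords y (ee, i, j, false) : ℝ) : ℂ) + ((coords y (ee, i, j, true) : ℝ) : ℂ) * Complex.I) q.1)) q.2.1 q.2.2.1) else 0) * fderiv ℝ uF (coords y) (fun q : Edge 3 L × Fin (fundamentalLatticeRep 2).N × Fin (fundamentalLatticeRep 2).N × Bool => if n.1 = q.1 then (fun z : ℂ => if q.2.2.2 then z.im else z.re) (((Real.sqrt 2 : ℂ) • ((fundamentalLatticeRep 2).lieProj (noiseDir n.2) * (fun (ee : Edge 3 L) => Matrix.of fun (i j : Fin (fundamentalLatticeRep 2).N) => ((coords y (ee, i, j, false) : ℝ) : ℂ) + ((coords y (ee, i, j, true) : ℝ) : ℂ)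 * Complex.I) q.1)) q.2.1 q.2.2.1) else 0) :=
      carre_eq_sum_frameDeriv_mul L β' uF uF y
    rw [e1]; exact Finset.sum_nonneg fun n _ => mul_self_nonneg _
  have hR : ∫ y, (∑ i : Edge 3 L × Fin 2 × Fin 2 × Bool, ∑ j : Edge 3 L × Fin 2 × Fin 2 × Bool, fderiv ℝ uF (coords y) (Pi.single i 1) * fderiv ℝ uF (coords y) (Pi.single j 1) * A y i j) ∂(κ s x) ≤ B := by
    calc ∫ y, (∑ i : Edge 3 L × Fin 2 × Fin 2 × Bool, ∑ j : Edge 3 L × Fin 2 × Fin 2 × Bool, fderiv ℝ uF (coords y) (Pi.single i 1) * fderiv ℝ uF (coords y) (Pi.single j 1) * A y i j) ∂(κ s x) ≤ ∫ _y, B ∂(κ s x) :=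
          integral_mono_of_nonneg (ae_of_all _ fun y => hΓu0 y) (integrable_const _) (ae_of_all _ fun y => by
            show (∑ i : Edge 3 L × Fin 2 × Fin 2 × Bool, ∑ j : Edge 3 L × Fin 2 × Fin 2 × Bool, fderiv ℝ uF (coords y) (Pi.single i 1) * fderiv ℝ uF (coords y) (Pi.single j 1) * A y i j) ≤ B
            rw [hΓu y]; exact hub y)
      _ = B := by simp
  have hexp : 0 < Real.exp (2 * (1 - 12 * |β'|) * (s : ℝ)) := Real.exp_pos _
  rw [Real.exp_neg, le_inv_mul_iff₀ hexp]
  exact h1.trans hR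

end Summit.QuantumFields.YangMills.Theorems.ColdStartUniversality
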